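import Mathlib
import Literature.AlgebraicGeometry.Resolution.CobordantGame
import Literature.AlgebraicGeometry.Resolution.CobordantChartCoefficients
import Summits.ResolutionOfSingularities.ResolutionOfSingularities.Theorems.WeightedInvariantLocalWeightedDropTwistedTrivialTransportPrep
import Summits.ResolutionOfSingularities.ResolutionOfSingularities.Theorems.WeightedInvariantLocalWeightedDropTwistedTrivialXOrder
import Summits.ResolutionOfSingularities.ResolutionOfSingularities.Theorems.WeightedInvariantLocalWeightedDropOrbitQuasiInvariance

/-!
# `WeightedInvariant.LocalWeightedDrop`: THE CONE KERNEL IDENTITY (card A round 6, (R6-K)/(R6-Q))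

Route `ResolutionOfSingularities/WeightedInvariant`, crux `LocalWeightedDrop` (stmt-ResolutionOfSingularities-8899); card A
of crux `WeightedConstruction` (stmt-ResolutionOfSingularities-0571).  [OURS · L1 W4.3] — res-type-099 (gen 13), ideator
res-L1-w43-idea-1's ROUND-7 item (r7-4) «`Cone.stub_cone_kernel` proof (or hand to 099)» (HANDOFF §GEN 6; Sketch v6
`Sketch-L1-idea-1.lean` sha16 404937b0a6007833 §12, excerpt `Sketch-L1-idea-1.s12-excerpt.r6.lean` cad79fd647ef5098).  The
definitions `Cone.sliceE`, `Cone.cylinder0`, `Cone.wDeg`, `Cone.wPart`, `Cone.IsConePoint` and the statements of `cone_kernel`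
(the sketch's `stub_cone_kernel`, now a theorem) and `sfree_of_initial` are the sketch's, VERBATIM; the proofs are ours.
Nothing here is a statement of the manuscript under review on ladder RESOLUTION; AI-produced, weaker than expert review.

THE IDENTITY (`cone_kernel`).  For weights `w`, a degree `d` ADMISSIBLE for `F′` (`hadm` = `IsAdmissible F′ w d` of
`…SaturatedDrop` UNFOLDED — every monomial of `F′` has `w`-weight `≥ d > 0` — so that this file stays out of the route
file's import cone; a caller holding `hadm : IsAdmissible F′ w d` passes it as is), a non-zero `w`-initial form
`wPart w d F′ ≠ 0`, and a factorisation through the crux chart at `c`, `F′(chart_c) = sᵃ · g` with `s ∤ g`: the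
exponent is `a = d`, and the initial form read through the chart is `s^d · (g|_{s=0} ⊗ 1)` — the successor restricted to the exceptional divisor IS the cone germ (the translate of the initial
form to the cone point).  Scheme form: Włodarczyk arXiv:2203.03090 L.4.1.7/4.1.10 (cited by the sketch; not used here).

PROOF = `s`-ADIC BOOKKEEPING over the folklore chart calculus `Literature/…/CobordantChartCoefficients` (crux convention
`c′ⱼ = 0` where `wⱼ = 0`, `cruxChart_eq_chart`): `a = weightedOrder_w F′` (`eq_weightedOrder_of_factor`) `= d` (admissible +
tight); coefficientwise (`coeff_subst_chart`) the `s^b`-layer of `(wPart w d F′)(chart)` is empty for `b ≠ d` and equals the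
`s^d`-layer of `F′(chart)` for `b = d`, which is the `s⁰`-layer of `g` (`coeff_cons_of_eq_X_pow_mul`), i.e. `g|_{s=0}`
(`coeff_sliceE`, `coeff_cylinder0`).  `TwistedTransport.hasSubst_Xsucc` is reused from `…TwistedTrivialTransportPrep`.
-/

set_option linter.dupNamespace false -- mandated namespace of this single-conjunct summit
set_option autoImplicit false

namespace Summit.ResolutionOfSingularities.ResolutionOfSingularities.Theorems

namespace GradedGame

namespace Cone

open MvPowerSeries
open Literature.AlgebraicGeometry.Resolution
open Literature.AlgebraicGeometry.Resolution.CobordantChart (chart cruxChart_eq_chart hasSubst_chart coeff_subst_chart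
  eq_weightedOrder_of_factor coeff_cons_of_eq_X_pow_mul)

variable {k : Type} [Field k]

variable {n : ℕ}

/-! ## The sketch's §12 vocabulary (VERBATIM) -/

/-- `g|_{s=0}` as an `n`-variable germ (`s` = variable `0` of `k⟦s, y₁..yₙ⟧`, as in `cruxChart`).
[OURS · L1 W4.3, Sketch-L1-idea-1 v6 §12 — VERBATIM] -/
noncomputable def sliceE (g : MvPowerSeries (Fin (n + 1)) k) : MvPowerSeries (Fin n) k :=
  subst (fun i : Fin (n + 1) => Fin.cases (0 : MvPowerSeries (Fin n) k) (fun j => X j) i) g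

/-- The cylinder with idle FIRST variable: `H(y) ∈ k⟦s, y⟧`. [OURS · L1 W4.3, Sketch-L1-idea-1 v6 §12 — VERBATIM] -/
noncomputable def cylinder0 (H : MvPowerSeries (Fin n) k) : MvPowerSeries (Fin (n + 1)) k :=
  subst (fun j : Fin n => (X j.succ : MvPowerSeries (Fin (n + 1)) k)) H

/-- The `w`-degree of an exponent. [OURS · L1 W4.3, Sketch-L1-idea-1 v6 §12 — VERBATIM] -/
def wDeg (w : Fin n → ℕ) (e : Fin n →₀ ℕ) : ℕ := ∑ i, w i * e i

/-- The `w`-degree-`d` part of `F`; for `(w, d)` admissible this is the `w`-INITIAL FORM `in_w F` (a power series in the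
weight-`0` variables, polynomial in the others). [OURS · L1 W4.3, Sketch-L1-idea-1 v6 §12 — VERBATIM] -/
noncomputable def wPart (w : Fin n → ℕ) (d : ℕ) (F : MvPowerSeries (Fin n) k) : MvPowerSeries (Fin n) k :=
  fun e => if wDeg w e = d then F e else 0

/-- Cone point of the move: a point of the exceptional divisor off the vertex (exactly where `cruxChart` translates).
[OURS · L1 W4.3, Sketch-L1-idea-1 v6 §12 — VERBATIM] -/
def IsConePoint (w : Fin n → ℕ) (c : Fin n → k) : Prop := ∃ i, 0 < w i ∧ c i ≠ 0

/-! ## Coefficient bookkeeping -/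

/-- Mathlib's `Finsupp.weight` is the sketch's `wDeg`. [OURS · L1 W4.3] -/
theorem weight_eq_wDeg (w : Fin n → ℕ) (e : Fin n →₀ ℕ) : Finsupp.weight w e = wDeg w e := by
  rw [Finsupp.weight_apply, wDeg, Finsupp.sum_fintype _ _ (fun _ => by simp)]
  exact Finset.sum_congr rfl fun i _ => by rw [smul_eq_mul, mul_comm]

/-- Coefficients of the initial form. [OURS · L1 W4.3] -/
theorem coeff_wPart (w : Fin n → ℕ) (d : ℕ) (F : MvPowerSeries (Fin n) k) (e : Fin n →₀ ℕ) :
    coeff e (wPart w d F) = if wDeg w e = d then coeff e F else 0 := by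
  rw [coeff_apply, coeff_apply]; rfl

/-- The substitution family of `sliceE` has zero constant terms. [OURS · L1 W4.3] -/
theorem constantCoeff_sliceFam (i : Fin (n + 1)) :
    constantCoeff (Fin.cases (0 : MvPowerSeries (Fin n) k) (fun j => X j) i : MvPowerSeries (Fin n) k) = 0 := by
  refine Fin.cases ?_ (fun j => ?_) i
  · simp
  · simp [constantCoeff_X]

/-- … hence is substitutable. [OURS · L1 W4.3] -/
theorem hasSubst_sliceFam :
    HasSubst (fun i : Fin (n + 1) => Fin.cases (0 : MvPowerSeries (Fin n) k) (fun j => X j) i) :=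
  hasSubst_of_constantCoeff_zero constantCoeff_sliceFam

/-- `sliceE` kills multiples of `s`. [OURS · L1 W4.3] -/
theorem sliceE_X_zero_mul (G : MvPowerSeries (Fin (n + 1)) k) : sliceE ((X 0 : MvPowerSeries (Fin (n + 1)) k) * G) = 0 := by
  unfold sliceE
  rw [subst_mul hasSubst_sliceFam, subst_X hasSubst_sliceFam]
  simp

/-- `sliceE` is a left inverse of `cylinder0`. [OURS · L1 W4.3] -/
theorem sliceE_cylinder0 (H : MvPowerSeries (Fin n) k) : sliceE (cylinder0 H) = H := by
  unfold sliceE cylinder0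
  rw [subst_comp_subst_apply TwistedTransport.hasSubst_Xsucc hasSubst_sliceFam]
  have hfam : (fun j : Fin n => subst (fun i : Fin (n + 1) => Fin.cases (0 : MvPowerSeries (Fin n) k) (fun j => X j) i)
      (X j.succ : MvPowerSeries (Fin (n + 1)) k)) = X := by
    funext j
    rw [subst_X hasSubst_sliceFam, Fin.cases_succ]
  rw [hfam]
  exact congr_fun subst_self H

/-- `sliceE` is additive. [OURS · L1 W4.3] -/
theorem sliceE_add (G G' : MvPowerSeries (Fin (n + 1)) k) : sliceE (G + G') = sliceE G + sliceE G' := by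
  unfold sliceE; rw [subst_add hasSubst_sliceFam]

/-- The identity exponent map. [OURS · L1 W4.3] -/
theorem linExp_single_one (e : Fin n →₀ ℕ) : linExp (fun j : Fin n => Finsupp.single j 1) e = e := by
  classical
  ext u
  rw [linExp_apply, Finsupp.sum, Finset.sum_eq_single u]
  · simp
  · intro v _ hv; simp [hv]
  · intro hu; rw [Finsupp.notMem_support_iff.mp hu, zero_mul]

/-- A product of powers of the variables is a monomial. [OURS · L1 W4.3] -/
theorem prod_X_pow_eq_monomial (e : Fin n →₀ ℕ) :
    (∏ j : Fin n, (X j : MvPowerSeries (Fin n) k) ^ e j) = monomial e (1 : k) := by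
  have h1 : (∏ j : Fin n, (X j : MvPowerSeries (Fin n) k) ^ e j) =
      e.prod fun j r => (monomial (Finsupp.single j 1) (1 : k) : MvPowerSeries (Fin n) k) ^ r := by
    rw [Finsupp.prod_fintype _ _ (fun i => by rw [pow_zero])]
    exact Finset.prod_congr rfl fun j _ => by rw [X_def]
  rw [h1, prod_pow_monomial_linExp, linExp_single_one]

/-- The substituted monomial of `sliceE` at an `s`-free exponent `(0, β)` is `y^β`. [OURS · L1 W4.3] -/
theorem prod_sliceFam_cons_zero (β : Fin n →₀ ℕ) :
    ((Finsupp.cons 0 β : Fin (n + 1) →₀ ℕ).prod fun i r =>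
        (Fin.cases (0 : MvPowerSeries (Fin n) k) (fun j => X j) i : MvPowerSeries (Fin n) k) ^ r) =
      monomial β (1 : k) := by
  rw [Finsupp.prod_fintype _ _ (fun i => by rw [pow_zero]), Fin.prod_univ_succ]
  simp only [Finsupp.cons_zero, pow_zero, one_mul, Fin.cases_succ, Finsupp.cons_succ]
  exact prod_X_pow_eq_monomial β

/-- COEFFICIENTS OF THE CYLINDER: `coeff (b, β) (H ⊗ 1) = [b = 0] · coeff β H`. [OURS · L1 W4.3] -/
theorem coeff_cylinder0 (H : MvPowerSeries (Fin n) k) (b : ℕ) (β : Fin n →₀ ℕ) :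
    coeff (Finsupp.cons b β) (cylinder0 H) = if b = 0 then coeff β H else 0 := by
  classical
  -- `cylinder0` is the monomial substitution `yⱼ ↦ x^{e_{j+1}}`, with exponent map `β ↦ (0, β)`
  set ρ : Fin n → (Fin (n + 1) →₀ ℕ) := fun j => Finsupp.single j.succ 1 with hρ
  have hfam : (fun j : Fin n => (X j.succ : MvPowerSeries (Fin (n + 1)) k)) = fun j => monomial (ρ j) (1 : k) := by
    funext j; rw [X_def]
  have hρs : HasSubst (fun j => (monomial (ρ j) (1 : k) : MvPowerSeries (Fin (n + 1)) k)) := by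
    rw [← hfam]; exact TwistedTransport.hasSubst_Xsucc
  have hlin : ∀ e : Fin n →₀ ℕ, linExp ρ e = Finsupp.cons 0 e := by
    intro e
    ext u
    rw [linExp_apply]
    refine Fin.cases ?_ (fun j => ?_) u
    · rw [Finsupp.cons_zero]
      rw [Finsupp.sum]
      exact Finset.sum_eq_zero fun v _ => by simp [hρ, Fin.succ_ne_zero]
    · rw [Finsupp.cons_succ]
      rw [Finsupp.sum, Finset.sum_eq_single j]
      · simp [hρ]
      · intro v _ hv
        simp [hρ, (Fin.succ_injective _).ne hv]
      · intro hj
        rw [Finsupp.notMem_support_iff.mp hj, zero_mul]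
  unfold cylinder0
  rw [hfam]
  by_cases hb : b = 0
  · subst hb
    rw [if_pos rfl, ← hlin β]
    refine coeff_linExp_subst_monomial ρ hρs (fun e e' h => ?_) H β
    have := congrArg Finsupp.tail (show linExp ρ e = linExp ρ e' from h)
    rwa [hlin, hlin, Finsupp.tail_cons, Finsupp.tail_cons] at this
  · rw [if_neg hb]
    refine coeff_subst_monomial_eq_zero ρ hρs H _ fun e h => hb ?_
    have := congrArg (fun m => m 0) h
    simp only [hlin, Finsupp.cons_zero] at this
    exact this.symm

/-- COEFFICIENTS OF THE SLICE: `coeff β (g|_{s=0}) = coeff (0, β) g`. [OURS · L1 W4.3] -/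
theorem coeff_sliceE (g : MvPowerSeries (Fin (n + 1)) k) (β : Fin n →₀ ℕ) :
    coeff β (sliceE g) = coeff (Finsupp.cons 0 β) g := by
  classical
  unfold sliceE
  rw [coeff_subst hasSubst_sliceFam, finsum_eq_single _ (Finsupp.cons 0 β)]
  · -- the term at `(0, β)`: the substituted monomial is `y^β`
    rw [prod_sliceFam_cons_zero, coeff_monomial_same, smul_eq_mul, mul_one]
  · intro m hm
    -- any other exponent: either `m 0 ≠ 0` (a factor `0^{m 0} = 0`) or the `y`-monomial differs from `β`
    by_cases hm0 : m 0 = 0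
    · have hmt : m = Finsupp.cons 0 (Finsupp.tail m) := by rw [← hm0, Finsupp.cons_tail]
      have hne : Finsupp.tail m ≠ β := by
        intro h; exact hm (by rw [hmt, h])
      rw [hmt, prod_sliceFam_cons_zero, coeff_monomial_ne (Ne.symm hne), smul_zero]
    · have hprod : (m.prod fun i r =>
          (Fin.cases (0 : MvPowerSeries (Fin n) k) (fun j => X j) i : MvPowerSeries (Fin n) k) ^ r) = 0 := by
        rw [Finsupp.prod]
        exact Finset.prod_eq_zero (Finsupp.mem_support_iff.mpr hm0) (by simp [zero_pow hm0])
      rw [hprod, map_zero, smul_zero]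

/-! ## The cone kernel identity -/

/-- The crux chart ignores `cⱼ` where `wⱼ = 0`: it is the folklore chart at `c′ = c·[w > 0]`, which satisfies the crux
convention `c′ⱼ = 0` for `wⱼ = 0`. [OURS · L1 W4.3] -/
theorem cruxChart_eq_chart' (w : Fin n → ℕ) (c : Fin n → k) :
    CobordantGame.cruxChart k w c = chart w (fun i => if 0 < w i then c i else 0) :=
  cruxChart_eq_chart w c

/-- For an admissible degree with non-zero initial form, the `w`-order of `F′` is `d`. [OURS · L1 W4.3] -/
theorem weightedOrder_eq_of_admissible_tight (w : Fin n → ℕ) (d : ℕ) (F' : MvPowerSeries (Fin n) k)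
    (hadm : 0 < d ∧ ∀ m : Fin n →₀ ℕ, coeff m F' ≠ 0 → d ≤ ∑ i, w i * m i) (htight : wPart w d F' ≠ 0) :
    F'.weightedOrder w = d := by
  apply le_antisymm
  · obtain ⟨e, he⟩ : ∃ e, coeff e (wPart w d F') ≠ 0 := by
      by_contra! h
      exact htight (MvPowerSeries.ext fun e => by rw [h e, map_zero])
    rw [coeff_wPart] at he
    by_cases hwe : wDeg w e = d
    · rw [if_pos hwe] at he
      have := weightedOrder_le w he
      rwa [weight_eq_wDeg, hwe] at this
    · exact absurd (if_neg hwe) he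
  · refine nat_le_weightedOrder w fun e hlt => ?_
    by_contra hne
    have := hadm.2 e hne
    rw [weight_eq_wDeg, wDeg] at hlt
    exact absurd this (not_le.mpr (by exact_mod_cast hlt))

/-- **(R6-K) THE CONE KERNEL IDENTITY** (the sketch's `Cone.stub_cone_kernel`, now a theorem).  For an admissible move whose
initial form is non-zero, the exponent of a successor is `a = d` and the initial form read through the chart is
`s^d · (g|_{s=0} ⊗ 1)` — the successor on the exceptional divisor IS the cone germ.
[OURS · L1 W4.3; statement Sketch-L1-idea-1 v6 §12 VERBATIM, proof res-type-099] -/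
theorem cone_kernel (w : Fin n → ℕ) (d : ℕ) (c : Fin n → k) (F' : MvPowerSeries (Fin n) k) (a : ℕ)
    (g : MvPowerSeries (Fin (n + 1)) k) (hadm : 0 < d ∧ ∀ m : Fin n →₀ ℕ, coeff m F' ≠ 0 → d ≤ ∑ i, w i * m i)
    (htight : wPart w d F' ≠ 0)
    (hsucc : subst (CobordantGame.cruxChart k w c) F' = X 0 ^ a * g)
    (hg : ¬ ((X (0 : Fin (n + 1)) : MvPowerSeries (Fin (n + 1)) k) ∣ g)) :
    a = d ∧ subst (CobordantGame.cruxChart k w c) (wPart w d F') = X 0 ^ d * cylinder0 (sliceE g) := by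
  classical
  set c' : Fin n → k := fun i => if 0 < w i then c i else 0 with hc'def
  have hc' : ∀ i, w i = 0 → c' i = 0 := fun i hi => by simp [hc'def, hi]
  have hch : CobordantGame.cruxChart k w c = chart w c' := cruxChart_eq_chart' w c
  rw [hch] at hsucc ⊢
  have hF : F' ≠ 0 := by
    intro h; apply htight
    ext e; rw [coeff_wPart, h]; simp
  -- (1) the exponent
  have had : a = d := by
    have h1 := eq_weightedOrder_of_factor w c' hc' hF hsucc hg
    rw [weightedOrder_eq_of_admissible_tight w d F' hadm htight] at h1
    exact_mod_cast h1
  refine ⟨had, ?_⟩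
  subst had
  -- (2) the identity, coefficientwise in the layer `s^b y^β`
  ext m
  rw [← Finsupp.cons_tail m]
  set b := m 0
  set β := Finsupp.tail m
  -- left: the `s^b`-layer of the initial form's transform
  have hL : coeff (Finsupp.cons b β) (subst (chart w c') (wPart w a F')) =
      if b = a then coeff (Finsupp.cons a β) (subst (chart w c') F') else 0 := by
    rw [coeff_subst_chart w c' hc', coeff_subst_chart w c' hc']
    by_cases hb : b = a
    · rw [if_pos hb, hb]
      refine finsum_congr fun e => ?_
      by_cases hwe : Finsupp.weight w e = a
      · rw [if_pos hwe, if_pos hwe, coeff_wPart, if_pos (by rw [← weight_eq_wDeg]; exact hwe)]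
      · rw [if_neg hwe, if_neg hwe]
    · rw [if_neg hb]
      refine finsum_eq_zero_of_forall_eq_zero fun e => ?_
      by_cases hwe : Finsupp.weight w e = b
      · rw [if_pos hwe, coeff_wPart, if_neg, zero_mul]
        rw [← weight_eq_wDeg, hwe]; exact hb
      · rw [if_neg hwe]
  -- right: the `s^b`-layer of `s^a · (g|_{s=0} ⊗ 1)`
  have hR : coeff (Finsupp.cons b β) (X 0 ^ a * cylinder0 (sliceE g) : MvPowerSeries (Fin (n + 1)) k) =
      if b = a then coeff (Finsupp.cons a β) (subst (chart w c') F') else 0 := by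
    rw [X_pow_eq, coeff_monomial_mul]
    by_cases hab : a ≤ b
    · have hle : Finsupp.single (0 : Fin (n + 1)) a ≤ Finsupp.cons b β := by
        rw [Finsupp.single_le_iff, Finsupp.cons_zero]; exact hab
      have hsub : Finsupp.cons b β - Finsupp.single (0 : Fin (n + 1)) a = Finsupp.cons (b - a) β := by
        ext j
        refine Fin.cases ?_ (fun i => ?_) j
        · simp
        · simp [Finsupp.cons_succ, Fin.succ_ne_zero]
      rw [if_pos hle, one_mul, hsub, coeff_cylinder0]
      by_cases hb : b = a
      · rw [if_pos (by omega), if_pos hb, coeff_sliceE, coeff_cons_of_eq_X_pow_mul hsucc 0 β, add_zero]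
      · rw [if_neg (by omega), if_neg hb]
    · have hle : ¬ Finsupp.single (0 : Fin (n + 1)) a ≤ Finsupp.cons b β := by
        rw [Finsupp.single_le_iff, Finsupp.cons_zero]; exact hab
      rw [if_neg hle, if_neg (by omega)]
  rw [hL, hR]

/-- **(R6-Q) QUASI-HOMOGENEOUS ⇒ CYLINDER ROW** (sorry-free from (R6-K), as in the sketch): if `F′` is its own initial form,
every successor is `s`-free, `g = g|_{s=0} ⊗ 1`. [OURS · L1 W4.3; statement Sketch-L1-idea-1 v6 §12 VERBATIM] -/
theorem sfree_of_initial (w : Fin n → ℕ) (d : ℕ) (c : Fin n → k) (F' : MvPowerSeries (Fin n) k) (a : ℕ)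
    (g : MvPowerSeries (Fin (n + 1)) k) (hadm : 0 < d ∧ ∀ m : Fin n →₀ ℕ, coeff m F' ≠ 0 → d ≤ ∑ i, w i * m i)
    (hF : F' ≠ 0) (hhom : wPart w d F' = F')
    (hsucc : subst (CobordantGame.cruxChart k w c) F' = X 0 ^ a * g)
    (hg : ¬ ((X (0 : Fin (n + 1)) : MvPowerSeries (Fin (n + 1)) k) ∣ g)) :
    a = d ∧ g = cylinder0 (sliceE g) := by
  obtain ⟨rfl, hK⟩ := cone_kernel w d c F' a g hadm (by rwa [hhom]) hsucc hg
  rw [hhom, hsucc] at hK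
  exact ⟨rfl, mul_left_cancel₀ (pow_ne_zero a (X_zero_ne_zero (k := k) (m := n))) hK⟩

end Cone

end GradedGame

end Summit.ResolutionOfSingularities.ResolutionOfSingularities.Theorems
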